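import Literature.Geometry.Lorentzian.KerrRpCoercivity
import HarnessLib

/-!
# The pointwise `r^p` inequalities on Kerr in divergence form: `∑_μ ∂_μ (J̃^{fm}[rψ])^μ` bounds the
# `p = 1` and `p = 2` bulk densities from above, up to the transversal and zeroth-order errors

(family `gr`; infrastructure for the far-region `r^p`-weighted estimates behind statement **gr.S24**
— the named fact `Kerr.dafermosRodnianski_pHierarchy_scri` of `KerrDecayHierarchy.lean`;
namespace `Literature.Geometry.Lorentzian.Kerr`)

This file assembles the pointwise half of the Dafermos–Rodnianski `r^p` method on subextremal (indeed
any) Kerr in the ingoing Kerr–Schild chart, for `p = 1` and `p = 2`, in the form in which the energy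
identities of the tree consume it (`KerrSchild.cutoffModifiedCurrent_graph_identity_timeCutoff`,
`E4.graphFlux_sub_eq_integral_divergence`: the space-time integrand is the coordinate divergence of
the current). Let `Φ` be of class `C²` at a point `x` of the far region and solve the wave equation
there, `□_g Φ (x) = 0` (`KerrSchild.waveOperator (Kerr.inverseMetric M a) Φ x = 0` — e.g. the
extension by zero of an admissible wave, `KerrFarRegionCutoff.lean`); let `Ψ = rΦ` be its radiation
field, `J̃^{fm} = J^{fm}[r⁻²g⁻¹, Ψ]` the current of the multiplier `f(r) m` (`m` the outgoing null
vector of `KerrNullFrame.lean`) for the conformal coefficient field `r⁻² g⁻¹`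
(`Kerr.confInverseMetric`, `KerrConformalWave.lean`), and `u = dΨ(m)`, `v = dΨ(k)`, `|p̸|²` the frame
functionals of `dΨ(x)`. Then (`Kerr.sum_fderiv_rpCurrent_eq`)
`∑_μ ∂_μ (J̃^{fm})^μ (x) = 𝒱 Ψ · f u + K^{fm}[r⁻²g⁻¹]` (`KerrSchild.sum_fderiv_multiplierCurrent`
with `□_{r⁻²g⁻¹}Ψ = 𝒱Ψ`, `Kerr.waveOperator_confInverseMetric_radius_mul_eq_of_wave`), and by
`Kerr.rpOne_coercivity`, `Kerr.rpTwo_coercivity`: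

* `Kerr.rpOne_divergence_inequality` (**`p = 1`**, `f = r`; `M ≥ 0`, `r ≥ 16M`, `r ≥ 4|a|`):
  `⅛ u² + ⅛ |p̸|² ≤ r² ∑_μ ∂_μ (J̃^{rm})^μ + (2a⁴ + 208M²a²) r⁻⁴ v² + 8(M + |a|)² r⁻⁴ Ψ²`;
* `Kerr.rpTwo_divergence_inequality` (**`p = 2`**, `f = r² + C₁r`, `C₁ = Kerr.rpTwoConst M a`;
  `r ≥ C₁ + 16M + 4|a|`):
  `(r/2) u² + |p̸|² ≤ r² ∑_μ ∂_μ (J̃^{fm})^μ + (a² + 11M|a|)(r√r)⁻¹ v² + 16(M + |a|)² r⁻³ Ψ²`.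

Integrated over the region between two leaves `Σ̃_s(h♯)`, `Σ̃_t(h♯)` in the far zone (measure `dt* dy`,
`det g = −1`), the left-hand sides are the bulk terms `∫ E^{(p−1)}_bulk` of Moschidis' Thm. 5.1 /
the `∫∫ r^{p−1}(p(∂_vΨ)² + (2 − p)|∇̸Ψ|²)` of (p-WE), the divergence becomes the difference of the
`J̃^{fm}`-fluxes through the leaves (densities in `KerrNullFrameFlux.lean`) plus cut-off terms, the
`v²`-terms are controlled by the far-region Morawetz estimate (weights `r⁻⁴`, `r^{-3/2}` in `(kΨ)²`,
i.e. at most `r^{-3/2}` in `(∂ψ)²`, below its `r^{-1-δ}`) and the `Ψ²`-terms by a Hardy inequality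
along the leaves. No named facts (D-0026).

## References

* M. Dafermos, I. Rodnianski, arXiv:0910.4957, §3 (p-WE-Mink), §4 (p-WE-Schw) (key
  `DafermosRodnianski2010ICMP`).
* G. Moschidis, arXiv:1509.08489 = Ann. PDE 2 (2016), Thm. 5.1, Lemma 4.1 (key `Moschidis2016`).
* M. Dafermos, I. Rodnianski, Y. Shlapentokh-Rothman, arXiv:1402.7034, §2.3.2, §3.3 (key
  `DafermosRodnianskiShlapentokhrothman2014`).
-/

noncomputable section

open Set Filter
open scoped Topology

namespace Literature.Geometry.Lorentzian.Kerr

variable {M a : ℝ} {x : E4}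

/-- The multiplier `X = f(r) m` is differentiable wherever `r > 0`, for `f` differentiable at `r(x)`.
[folklore] -/
theorem differentiableAt_radial_smul_outVector (M a : ℝ) (hx : 0 < radius a x) {f : ℝ → ℝ}
    (hf : DifferentiableAt ℝ f (radius a x)) (α : Fin 4) :
    DifferentiableAt ℝ (fun y ↦ f (radius a y) * outVector M a y α) x :=
  (hf.comp x ((contDiffAt_radius hx (n := 1)).differentiableAt one_ne_zero)).mul
    ((contDiffAt_outVector_apply M a hx (n := 1) α).differentiableAt one_ne_zero)

/-- `X(Ψ) = f u`: `∑_α (f m)^α ∂_αΨ = f · dΨ(m)`. [folklore] -/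
theorem sum_radial_smul_outVector_mul (M a : ℝ) (x : E4) (f : ℝ → ℝ) (p : Fin 4 → ℝ) :
    ∑ α, f (radius a x) * outVector M a x α * p α = f (radius a x) * frameOut M a x p := by
  rw [frameOut, Finset.mul_sum]
  exact Finset.sum_congr rfl fun α _ ↦ by ring

/-- **The divergence of the `r^p`-current of the radiation field.** For `Φ` of class `C²` at a point
`x` with `r > 0` solving `□_g Φ (x) = 0`, `f` differentiable at `r(x)`, and `Ψ = rΦ`:
`∑_μ ∂_μ (J^{fm}[r⁻²g⁻¹, Ψ])^μ (x) = 𝒱(x) Ψ(x) · f(r) u + K^{fm}[r⁻²g⁻¹](x)`, `u = dΨ_x(m)`.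
[cite: DafermosRodnianski2010ICMP, §3–§4] -/
theorem sum_fderiv_rpCurrent_eq (M a : ℝ) (hx : 0 < radius a x) {f : ℝ → ℝ}
    (hf : DifferentiableAt ℝ f (radius a x)) {Φ : E4 → ℝ} (hΦ : ContDiffAt ℝ 2 Φ x)
    (hwave : KerrSchild.waveOperator (inverseMetric M a) Φ x = 0) :
    ∑ μ, fderiv ℝ (fun y ↦ KerrSchild.multiplierCurrent (confInverseMetric M a)
        (fun z α ↦ f (radius a z) * outVector M a z α) (fun z ↦ radius a z * Φ z) y μ) x (E4.basisVector μ) =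
      confPotential M a x * (radius a x * Φ x) *
          (f (radius a x) * frameOut M a x (fun μ ↦ fderiv ℝ (fun z ↦ radius a z * Φ z) x (E4.basisVector μ))) +
        KerrSchild.multiplierBulk (confInverseMetric M a) (fun z α ↦ f (radius a z) * outVector M a z α)
          (fun z ↦ radius a z * Φ z) x := by
  have hG : ∀ μ ν, DifferentiableAt ℝ (fun y ↦ confInverseMetric M a y μ ν) x := fun μ ν ↦
    (contDiffAt_confInverseMetric M a hx μ ν (n := 1)).differentiableAt one_ne_zero
  have hsymm : ∀ μ ν, confInverseMetric M a x μ ν = confInverseMetric M a x ν μ :=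
    confInverseMetric_symm M a x
  have hX := differentiableAt_radial_smul_outVector M a hx hf
  have hΨ : ContDiffAt ℝ 2 (fun z ↦ radius a z * Φ z) x := (contDiffAt_radius hx).mul hΦ
  rw [KerrSchild.sum_fderiv_multiplierCurrent hG hsymm hX hΨ,
    waveOperator_confInverseMetric_radius_mul_eq_of_wave M a hx hΦ hwave, sum_radial_smul_outVector_mul]

/-- **The `p = 1` inequality in divergence form.** For `M ≥ 0`, a point `x` with `r = r(x) > 0`,
`r ≥ 16M`, `r ≥ 4|a|`, `Φ` of class `C²` at `x` with `□_g Φ (x) = 0`, and `Ψ = rΦ` with frame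
functionals `u, v, |p̸|²` of `dΨ(x)`:
`⅛ u² + ⅛ |p̸|² ≤ r² ∑_μ ∂_μ (J^{rm}[r⁻²g⁻¹, Ψ])^μ (x) + (2a⁴ + 208 M²a²) r⁻⁴ v² + 8 (M + |a|)² r⁻⁴ Ψ(x)²`.
[cite: DafermosRodnianski2010ICMP, §3–§4] -/
theorem rpOne_divergence_inequality (hM : 0 ≤ M) (hx : 0 < radius a x) (hrM : 16 * M ≤ radius a x)
    (hra : 4 * |a| ≤ radius a x) {Φ : E4 → ℝ} (hΦ : ContDiffAt ℝ 2 Φ x)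
    (hwave : KerrSchild.waveOperator (inverseMetric M a) Φ x = 0) :
    8⁻¹ * frameOut M a x (fun μ ↦ fderiv ℝ (fun z ↦ radius a z * Φ z) x (E4.basisVector μ)) ^ 2 +
        8⁻¹ * frameAngSq a x (fun μ ↦ fderiv ℝ (fun z ↦ radius a z * Φ z) x (E4.basisVector μ)) ≤
      radius a x ^ 2 *
          ∑ μ, fderiv ℝ (fun y ↦ KerrSchild.multiplierCurrent (confInverseMetric M a)
            (fun z α ↦ radius a z * outVector M a z α) (fun z ↦ radius a z * Φ z) y μ) x (E4.basisVector μ) +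
        (2 * a ^ 4 + 208 * M ^ 2 * a ^ 2) / radius a x ^ 4 *
          frameIn a x (fun μ ↦ fderiv ℝ (fun z ↦ radius a z * Φ z) x (E4.basisVector μ)) ^ 2 +
        8 * (M + |a|) ^ 2 / radius a x ^ 4 * (radius a x * Φ x) ^ 2 := by
  have hdiv := sum_fderiv_rpCurrent_eq M a hx (f := fun s ↦ s) differentiableAt_id hΦ hwave
  beta_reduce at hdiv
  rw [hdiv]
  have h := rpOne_coercivity hM hx hrM hra (fun z ↦ radius a z * Φ z)
  beta_reduce at h
  exact h

/-- **The `p = 2` inequality in divergence form.** For `M ≥ 0`, `C₁ = rpTwoConst M a`, a point `x` with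
`r = r(x) ≥ C₁ + 16M + 4|a|` (and `r > 0`), `Φ` of class `C²` at `x` with `□_g Φ (x) = 0`, `Ψ = rΦ`,
`f(r) = r² + C₁ r`:
`(r/2) u² + |p̸|² ≤ r² ∑_μ ∂_μ (J^{fm}[r⁻²g⁻¹, Ψ])^μ (x) + (a² + 11M|a|)(r√r)⁻¹ v² + 16(M + |a|)² r⁻³ Ψ(x)²`.
[cite: DafermosRodnianski2010ICMP, §3–§4] -/
theorem rpTwo_divergence_inequality (hM : 0 ≤ M) (hx : 0 < radius a x)
    (hR : rpTwoConst M a + 16 * M + 4 * |a| ≤ radius a x) {Φ : E4 → ℝ} (hΦ : ContDiffAt ℝ 2 Φ x)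
    (hwave : KerrSchild.waveOperator (inverseMetric M a) Φ x = 0) :
    radius a x / 2 * frameOut M a x (fun μ ↦ fderiv ℝ (fun z ↦ radius a z * Φ z) x (E4.basisVector μ)) ^ 2 +
        frameAngSq a x (fun μ ↦ fderiv ℝ (fun z ↦ radius a z * Φ z) x (E4.basisVector μ)) ≤
      radius a x ^ 2 *
          ∑ μ, fderiv ℝ (fun y ↦ KerrSchild.multiplierCurrent (confInverseMetric M a)
            (fun z α ↦ (radius a z ^ 2 + rpTwoConst M a * radius a z) * outVector M a z α)
            (fun z ↦ radius a z * Φ z) y μ) x (E4.basisVector μ) +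
        (a ^ 2 + 11 * M * |a|) / (radius a x * Real.sqrt (radius a x)) *
          frameIn a x (fun μ ↦ fderiv ℝ (fun z ↦ radius a z * Φ z) x (E4.basisVector μ)) ^ 2 +
        16 * (M + |a|) ^ 2 / radius a x ^ 3 * (radius a x * Φ x) ^ 2 := by
  have hfd : HasDerivAt (fun s : ℝ ↦ s ^ 2 + rpTwoConst M a * s) (2 * radius a x + rpTwoConst M a) (radius a x) := by
    have h := (hasDerivAt_pow 2 (radius a x)).add ((hasDerivAt_id (radius a x)).const_mul (rpTwoConst M a))
    refine h.congr_deriv ?_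
    simp only [Nat.cast_ofNat, Nat.add_one_sub_one, pow_one, mul_one]
  have hdiv := sum_fderiv_rpCurrent_eq M a hx (f := fun s ↦ s ^ 2 + rpTwoConst M a * s)
    hfd.differentiableAt hΦ hwave
  beta_reduce at hdiv
  rw [hdiv]
  have h := rpTwo_coercivity hM hx hR (fun z ↦ radius a z * Φ z)
  beta_reduce at h
  exact h

end Literature.Geometry.Lorentzian.Kerr
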